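import Literature.AlgebraicGeometry.ModuliOfAbelianVarieties.SiegelModuliInterpretation
import Literature.AlgebraicGeometry.ModuliOfAbelianVarieties.SiegelCMTorusMapsOfChart
import Literature.AlgebraicGeometry.Motives.ComplexTorusAlgebraicHomomorphisms
import Literature.AlgebraicGeometry.Motives.AbelianVarietyHomTorsionDetermined
import Literature.Geometry.Kaehler.ComplexTorusAnalyticCharpoly
import Literature.Geometry.Kaehler.ComplexTorusOfComplexStructure
import HarnessLib

/-!
# Homomorphisms of marked abelian varieties: GAGA for the adelic markings of the Siegel moduli reading
# ([Milne 2005] Thm. 6.11 «an isomorphism `A → A′` … sending `ηK` to `η′K`»; [Lange–Birkenhake] Prop. 1.2.1 / Cor. 2.1.17; [Shimura 1998] §7.4)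

Topic `AlgebraicGeometry/ModuliOfAbelianVarieties`; namespace `Literature.AlgebraicGeometry.ModuliOfAbelianVarieties.SiegelAdelicMarking`.
Cell hodgecm-mathlib (D-0151), #60 road / Mumford line (row I-7 `SiegelS1`; lead A-p05, skeleton B-plan1, census A-p06): the
MARKING-LEVEL API on top of the T1′ carrier ★ `SiegelAdelicMarking` (B-typ04, `SiegelModuliInterpretation`).  THEOREMS ONLY (no definition,
no named fact, no instance, no `sorry`; net Literature debt 0).  HC_CM is proved only modulo the printed citations until rung 0 closes.

## Setting
`m : SiegelAdelicMarking J a A` — a complex abelian variety `A` marked by the point `[J, a]` of the Siegel Shimura set: a rational basis matrix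
`γ` of `Λ_a = ℚ^{2g} ∩ a·ẑ^{2g}` (★ R60-19 `latticeOfGL`), complex coordinates `Ψ : ℝ^{2g} ≃ ℂ^g` with `Ψ(γ⁻¹ J x) = √−1·Ψ(γ⁻¹ x)`, and an
analytification `toFun : ℂ^g/Ψ(ℤ^{2g}) → A(ℂ)` which is a group homomorphism; `m.r v = toFun [γ⁻¹ v]` is the torsion parametrisation
`u_a : V = ℚ^{2g} → A(ℂ)` ([Milne2005ShimuraVarieties] Thm. 6.11, (63)).

## What is proved
* §1 `jMatrix_eq` — the complex structure of `ℂ^g/Ψ(ℤ^{2g})` in lattice coordinates is `γ⁻¹ J γ` (★ `Kaehler.ComplexTorus.jMatrix`).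
* §2 `exists_int_matrix_of_forall_mem` — `q·Λ_a ⊆ Λ_{a′}` makes `γ′⁻¹ q γ` an integer matrix.
* §3 **`exists_hom_forall_map_r_eq`** — a rational `q` with `q_ℝ J = J′ q_ℝ` and `γ′⁻¹ q γ` integral is induced by a homomorphism of ABELIAN
  VARIETIES `h : A ⟶ A′` with `h(u_a v) = u_{a′}(q v)` (holomorphy ★ `ComplexTorus.contMDiff_mapMatrix_of_mul_jMatrix`, algebraicity ★
  `AbelianVariety.exists_hom_of_mdifferentiable_complexTorus`); `…_of_forall_mem` the lattice-hypothesis form.  (Siegel twin of ★ (G2)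
  `CMTypeUniformization.exists_hom_forall_map_r_eq`.)
* §4 `hom_eq_of_forall_map_r_eq` — homomorphisms out of a marked `A` are determined on `u_a(V) = A(ℂ)_tors` (★ `hom_eq_of_forall_torsionPoints_map`).
* §5 **`exists_iso_forall_map_r_eq`**, **`exists_iso_forall_map_r_eq_self`** — the isomorphism case; two markings of ONE point `[J, a]` on `A`, `A′`
  differ by `e : A ≅ A′` with `e(u v) = u′(v)` (closes the Mumford skeleton's stub (U) `MarkingTransport`).
* §6 **`exists_hom_map_r_act_eq_r`**, **`exists_hom_map_r_eq_r_act_single`** — the hetero junction with a principal CM structure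
  `(B, ιB, ξ)` of type `(Kᵢ, Φᵢ, 𝔟)` through the period chart of a special pair (★ R60-51 `CMStructure.exists_hom_map_chart_eq_r` /
  `exists_hom_map_r_eq_chart`, A-p06, at the marking's own chart): `χ(u(act(x)·v₀)) = ξ.r(xᵢ)` and `θ(ξ.r y) = u(act(ιᵢ(M·y))·v₀)`
  (with ★ R60-54 `IsSpecial.exists_periodIso_at` these give the Mumford line's junction (α∀) for EVERY marking).

## References
* [Milne2005ShimuraVarieties] J. S. Milne, *Introduction to Shimura varieties* (2005), §4 pp. 48–49; §6 Thm. 6.11 p. 74; (63) p. 116; Ex. 12.4 (b) p. 112.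
* [LangeBirkenhake1992] H. Lange, Ch. Birkenhake, *Complex Abelian Varieties* (1992), §1.1.2; Ch. 1 Prop. 1.2.1; Ch. 2 Cor. 2.1.17.
* [Shimura1998] G. Shimura, *Abelian Varieties with Complex Multiplication and Modular Functions* (1998), §7.4 Prop. 15 p. 53, Prop. 17 p. 54; §18.6 Thm. 18.6 (2) pp. 124–125.
* [Deligne1971TravauxShimura] P. Deligne, *Travaux de Shimura*, Sém. Bourbaki 389 (1971), 4.18–4.21 pp. 150–152.
* [Milne1986AbelianVarieties] J. S. Milne, *Abelian Varieties* (1986), §12 Lemma 12.6.  [MumfordAV1970] D. Mumford, *Abelian Varieties*, §19 Thm. 3.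
-/

set_option autoImplicit false

noncomputable section

namespace Literature.AlgebraicGeometry.ModuliOfAbelianVarieties

namespace SiegelAdelicMarking

open scoped Manifold ContDiff nonZeroDivisors
open Matrix CategoryTheory NumberField IsDedekindDomain
open Literature.AlgebraicGeometry.Motives (AbelianVariety ComplexPoints AlgPoints CMType)
open Literature.Geometry.Kaehler (ComplexTorus)
open Literature.Geometry.Kaehler.ComplexTorus (jMatrix latticeJ mapMatrix proj mapMatrix_proj jMatrix_mulVec
  apply_latticeJ latticeJ_apply contMDiff_mapMatrix_of_mul_jMatrix mapMatrix_mapMatrix mapMatrix_one mapMatrix_add)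
open Literature.NumberTheory.Adeles (latticeOfGL mem_latticeOfGL_map_iff mem_latticeOfGL_map_iff_exists)

variable {g : ℕ} {δ : Fin g → ℕ} {J J' : C0pm δ} {a a' : gspFinAdelic δ} {A A' : AbelianVariety ℂ}

/-! ### §1. The complex structure of a marked torus in lattice coordinates -/

/-- Casting `γ⁻¹ γ = 1` to `ℝ`. [folklore] -/
private theorem map_inv_mul_map (γ : GL (Fin g ⊕ Fin g) ℚ) :
    ((γ⁻¹ : GL (Fin g ⊕ Fin g) ℚ) : Matrix (Fin g ⊕ Fin g) (Fin g ⊕ Fin g) ℚ).map (algebraMap ℚ ℝ) *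
        ((γ : GL (Fin g ⊕ Fin g) ℚ) : Matrix (Fin g ⊕ Fin g) (Fin g ⊕ Fin g) ℚ).map (algebraMap ℚ ℝ) = 1 := by
  rw [← Matrix.map_mul, ← Units.val_mul, inv_mul_cancel, Units.val_one, Matrix.map_one _ (map_zero _) (map_one _)]

/-- Casting `γ γ⁻¹ = 1` to `ℝ`. [folklore] -/
private theorem map_mul_map_inv (γ : GL (Fin g ⊕ Fin g) ℚ) :
    ((γ : GL (Fin g ⊕ Fin g) ℚ) : Matrix (Fin g ⊕ Fin g) (Fin g ⊕ Fin g) ℚ).map (algebraMap ℚ ℝ) *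
        ((γ⁻¹ : GL (Fin g ⊕ Fin g) ℚ) : Matrix (Fin g ⊕ Fin g) (Fin g ⊕ Fin g) ℚ).map (algebraMap ℚ ℝ) = 1 := by
  rw [← Matrix.map_mul, ← Units.val_mul, mul_inv_cancel, Units.val_one, Matrix.map_one _ (map_zero _) (map_one _)]

/-- **The complex structure of the marked torus `ℂ^g/Ψ(ℤ^{2g})` in lattice coordinates is `γ⁻¹ J γ`**: the field `Ψ_J`
(`Ψ(γ⁻¹ J x) = i·Ψ(γ⁻¹ x)`) says exactly that `Ψ⁻¹ ∘ i ∘ Ψ = γ⁻¹ J γ` on `ℝ^{2g}` (★ `Kaehler.ComplexTorus.jMatrix`, the rational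
representation of `i`). [cite: LangeBirkenhake1992, §1.1.2] [cite: Milne2005ShimuraVarieties, §6 Thm. 6.11] -/
theorem jMatrix_eq (m : SiegelAdelicMarking J a A) :
    jMatrix m.Ψ =
      ((m.γ⁻¹ : GL (Fin g ⊕ Fin g) ℚ) : Matrix (Fin g ⊕ Fin g) (Fin g ⊕ Fin g) ℚ).map (algebraMap ℚ ℝ) *
        (J : Matrix (Fin g ⊕ Fin g) (Fin g ⊕ Fin g) ℝ) *
          ((m.γ : GL (Fin g ⊕ Fin g) ℚ) : Matrix (Fin g ⊕ Fin g) (Fin g ⊕ Fin g) ℚ).map (algebraMap ℚ ℝ) := by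
  refine Matrix.toLin'.injective (LinearMap.ext fun y => ?_)
  rw [Matrix.toLin'_apply, Matrix.toLin'_apply, jMatrix_mulVec, latticeJ_apply]
  apply m.Ψ.injective
  rw [ContinuousLinearEquiv.apply_symm_apply, ← Matrix.mulVec_mulVec, ← Matrix.mulVec_mulVec, m.Ψ_J,
    Matrix.mulVec_mulVec, map_inv_mul_map, Matrix.one_mulVec]

/-! ### §2. Lattice compatibility of a rational matrix: `q·Λ_a ⊆ Λ_{a′}` iff `γ′⁻¹ q γ` is integral -/

/-- **`q·Λ_a ⊆ Λ_{a′}` makes `γ′⁻¹ q γ` an integer matrix** (`Λ_a = γ ℤ^{2g}`, `Λ_{a′} = γ′ ℤ^{2g}`, ★ R60-19 `latticeOfGL`,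
★ T1′ `isLatticeBasis_iff_latticeOfGL_eq`). [cite: Milne2005ShimuraVarieties, §4 pp. 48–49; §6 Thm. 6.11] -/
theorem exists_int_matrix_of_forall_mem (m : SiegelAdelicMarking J a A) (m' : SiegelAdelicMarking J' a' A')
    (q : Matrix (Fin g ⊕ Fin g) (Fin g ⊕ Fin g) ℚ)
    (hq : ∀ v ∈ latticeOfGL (a : GL (Fin g ⊕ Fin g) finAdeleQ), q *ᵥ v ∈ latticeOfGL (a' : GL (Fin g ⊕ Fin g) finAdeleQ)) :
    ∃ N : Matrix (Fin g ⊕ Fin g) (Fin g ⊕ Fin g) ℤ,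
      N.map (Int.cast : ℤ → ℚ) =
        ((m'.γ⁻¹ : GL (Fin g ⊕ Fin g) ℚ) : Matrix (Fin g ⊕ Fin g) (Fin g ⊕ Fin g) ℚ) * q *
          ((m.γ : GL (Fin g ⊕ Fin g) ℚ) : Matrix (Fin g ⊕ Fin g) (Fin g ⊕ Fin g) ℚ) := by
  have ha := (isLatticeBasis_iff_latticeOfGL_eq a m.γ).1 m.γ_isLatticeBasis
  have ha' := (isLatticeBasis_iff_latticeOfGL_eq a' m'.γ).1 m'.γ_isLatticeBasis
  -- column `j` of `γ′⁻¹ q γ` is `γ′⁻¹ (q (γ e_j))`, integral because `q (γ e_j) ∈ Λ_{a′} = γ′ ℤ^{2g}`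
  have hcol : ∀ j i, ∃ z : ℤ, (z : ℚ) =
      (((m'.γ⁻¹ : GL (Fin g ⊕ Fin g) ℚ) : Matrix (Fin g ⊕ Fin g) (Fin g ⊕ Fin g) ℚ) *ᵥ
        (q *ᵥ (((m.γ : GL (Fin g ⊕ Fin g) ℚ) : Matrix (Fin g ⊕ Fin g) (Fin g ⊕ Fin g) ℚ) *ᵥ
          (Pi.single j 1 : Fin g ⊕ Fin g → ℚ)))) i := by
    intro j
    have hmem : ((m.γ : GL (Fin g ⊕ Fin g) ℚ) : Matrix (Fin g ⊕ Fin g) (Fin g ⊕ Fin g) ℚ) *ᵥ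
        (Pi.single j 1 : Fin g ⊕ Fin g → ℚ) ∈ latticeOfGL (a : GL (Fin g ⊕ Fin g) finAdeleQ) := by
      rw [ha, mem_latticeOfGL_map_iff_exists]
      exact ⟨Pi.single j 1, by congr 1; funext k; simp [Pi.single_apply]⟩
    have h2 := hq _ hmem
    rw [ha', mem_latticeOfGL_map_iff] at h2
    exact h2
  choose z hz using hcol
  refine ⟨Matrix.of fun i j => z j i, ?_⟩
  ext i j
  rw [Matrix.map_apply, Matrix.of_apply, hz j i, Matrix.mulVec_mulVec, Matrix.mulVec_mulVec]
  simp [Matrix.mulVec, dotProduct, Pi.single_apply]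

/-! ### §3. GAGA: a `J`-linear, lattice-compatible rational matrix is a homomorphism of the marked abelian varieties -/

/-- Casting the integer matrix `N` with `N_ℚ = γ′⁻¹ q γ` to `ℝ`. [folklore] -/
private theorem map_int_eq {q : Matrix (Fin g ⊕ Fin g) (Fin g ⊕ Fin g) ℚ} {N : Matrix (Fin g ⊕ Fin g) (Fin g ⊕ Fin g) ℤ}
    {γ γ' : GL (Fin g ⊕ Fin g) ℚ}
    (hN : N.map (Int.cast : ℤ → ℚ) =
      ((γ'⁻¹ : GL (Fin g ⊕ Fin g) ℚ) : Matrix (Fin g ⊕ Fin g) (Fin g ⊕ Fin g) ℚ) * q * (γ : Matrix (Fin g ⊕ Fin g) (Fin g ⊕ Fin g) ℚ)) :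
    N.map (Int.cast : ℤ → ℝ) =
      ((γ'⁻¹ : GL (Fin g ⊕ Fin g) ℚ) : Matrix (Fin g ⊕ Fin g) (Fin g ⊕ Fin g) ℚ).map (algebraMap ℚ ℝ) *
        q.map (algebraMap ℚ ℝ) * (γ : Matrix (Fin g ⊕ Fin g) (Fin g ⊕ Fin g) ℚ).map (algebraMap ℚ ℝ) := by
  have h : N.map (Int.cast : ℤ → ℝ) = (N.map (Int.cast : ℤ → ℚ)).map (algebraMap ℚ ℝ) := by
    ext i j; simp only [Matrix.map_apply, eq_ratCast, Rat.cast_intCast]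
  rw [h, hN, Matrix.map_mul, Matrix.map_mul]

/-- **GAGA FOR MARKINGS.**  Let `m`, `m′` be markings of `A`, `A′` by `[J, a]`, `[J′, a′]`, and `q` a rational matrix on `V = ℚ^{2g}`
which is `ℂ`-LINEAR for the two complex structures (`q_ℝ J = J′ q_ℝ`) and LATTICE-COMPATIBLE (`γ′⁻¹ q γ = N` integral, i.e.
`q·Λ_a ⊆ Λ_{a′}`).  Then the holomorphic torus homomorphism `N : ℂ^g/Ψ(ℤ^{2g}) → ℂ^g/Ψ′(ℤ^{2g})` is induced by a homomorphism of
ABELIAN VARIETIES `h : A ⟶ A′`, and on the torsion parametrisations `h(u_a(v)) = u_{a′}(q·v)` for every `v ∈ V` — [Milne2005ShimuraVarieties]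
Thm. 6.11 («an isomorphism `A → A′` … sending `ηK` to `η′K`», here for any lattice-compatible `q`); [LangeBirkenhake1992] Prop. 1.2.1
with Cor. 2.1.17 (holomorphic maps of tori are homomorphisms; Chow); the Siegel-coordinates twin of ★ `CMTypeUniformization.exists_hom_forall_map_r_eq`
([Shimura1998] §7.4 Prop. 15). [cite: Milne2005ShimuraVarieties, §6 Thm. 6.11] [cite: LangeBirkenhake1992, Ch. 1 Prop. 1.2.1 and Ch. 2 Cor. 2.1.17]
[cite: Shimura1998, §7.4 Prop. 15 p. 53] -/
theorem exists_hom_forall_map_r_eq (m : SiegelAdelicMarking J a A) (m' : SiegelAdelicMarking J' a' A')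
    (q : Matrix (Fin g ⊕ Fin g) (Fin g ⊕ Fin g) ℚ)
    (hqJ : q.map (algebraMap ℚ ℝ) * (J : Matrix (Fin g ⊕ Fin g) (Fin g ⊕ Fin g) ℝ) =
      (J' : Matrix (Fin g ⊕ Fin g) (Fin g ⊕ Fin g) ℝ) * q.map (algebraMap ℚ ℝ))
    (N : Matrix (Fin g ⊕ Fin g) (Fin g ⊕ Fin g) ℤ)
    (hN : N.map (Int.cast : ℤ → ℚ) =
      ((m'.γ⁻¹ : GL (Fin g ⊕ Fin g) ℚ) : Matrix (Fin g ⊕ Fin g) (Fin g ⊕ Fin g) ℚ) * q *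
        ((m.γ : GL (Fin g ⊕ Fin g) ℚ) : Matrix (Fin g ⊕ Fin g) (Fin g ⊕ Fin g) ℚ)) :
    ∃ h : A ⟶ A', ∀ v : Fin g ⊕ Fin g → ℚ, AlgPoints.map h.hom.hom.hom (m.r v) = m'.r (q *ᵥ v) := by
  -- `N` commutes with the complex structures `γ⁻¹ J γ`, `γ′⁻¹ J′ γ′`
  have hNJ : N.map (Int.cast : ℤ → ℝ) * jMatrix m.Ψ = jMatrix m'.Ψ * N.map (Int.cast : ℤ → ℝ) := by
    rw [map_int_eq hN, m.jMatrix_eq, m'.jMatrix_eq]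
    rw [show ∀ X Y Z U V W : Matrix (Fin g ⊕ Fin g) (Fin g ⊕ Fin g) ℝ, X * Y * Z * (U * V * W) = X * Y * (Z * U) * V * W from
      fun X Y Z U V W => by simp only [Matrix.mul_assoc]]
    rw [show ∀ X Y Z U V W : Matrix (Fin g ⊕ Fin g) (Fin g ⊕ Fin g) ℝ, X * Y * Z * (U * V * W) = X * Y * (Z * U) * V * W from
      fun X Y Z U V W => by simp only [Matrix.mul_assoc]]
    rw [map_mul_map_inv, map_mul_map_inv, Matrix.mul_one, Matrix.mul_one, Matrix.mul_assoc _ (q.map _), hqJ,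
      ← Matrix.mul_assoc]
  -- hence the torus homomorphism `N` is holomorphic, hence algebraic
  have hhol : MDifferentiable 𝓘(ℂ, Fin g → ℂ) 𝓘(ℂ, Fin g → ℂ) (mapMatrix m.Ψ m'.Ψ N) :=
    (contMDiff_mapMatrix_of_mul_jMatrix m.Ψ m'.Ψ (n := 1) hNJ).mdifferentiable one_ne_zero
  have h0 : mapMatrix m.Ψ m'.Ψ N 0 = 0 := by
    have h2 := mapMatrix_add (Φ := m.Ψ) (Φ' := m'.Ψ) N 0 0
    rw [add_zero] at h2
    exact add_eq_left.1 h2.symm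
  obtain ⟨h, hh⟩ := AbelianVariety.exists_hom_of_mdifferentiable_complexTorus m.isAnalytification m'.isAnalytification
    m.toFun_zero m'.toFun_zero hhol h0
  refine ⟨h, fun v => ?_⟩
  rw [m.r_def, m'.r_def, ← hh, mapMatrix_proj]
  congr 2
  -- `N_ℝ · (γ⁻¹ v) = γ′⁻¹ (q v)` (computed over `ℚ`, cast to `ℝ`)
  have hN' : N.map (Int.cast : ℤ → ℝ) = (N.map (Int.cast : ℤ → ℚ)).map (Rat.castHom ℝ) := by
    ext i j; simp only [Matrix.map_apply, Rat.coe_castHom, Rat.cast_intCast]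
  funext i
  rw [hN']
  change ((N.map (Int.cast : ℤ → ℚ)).map (Rat.castHom ℝ) *ᵥ
      (⇑(Rat.castHom ℝ) ∘ (((m.γ⁻¹ : GL (Fin g ⊕ Fin g) ℚ) : Matrix (Fin g ⊕ Fin g) (Fin g ⊕ Fin g) ℚ) *ᵥ v))) i =
    Rat.castHom ℝ
      ((((m'.γ⁻¹ : GL (Fin g ⊕ Fin g) ℚ) : Matrix (Fin g ⊕ Fin g) (Fin g ⊕ Fin g) ℚ) *ᵥ (q *ᵥ v)) i)
  rw [← RingHom.map_mulVec, hN, Matrix.mulVec_mulVec, Matrix.mulVec_mulVec, Matrix.mul_assoc,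
    Matrix.mul_assoc, ← Units.val_mul, mul_inv_cancel, Units.val_one, Matrix.mul_one]

/-- **The lattice-hypothesis form**: `q_ℝ J = J′ q_ℝ` and `q·Λ_a ⊆ Λ_{a′}` give `h : A ⟶ A′` with `h(u_a v) = u_{a′}(q v)`.
[cite: Milne2005ShimuraVarieties, §6 Thm. 6.11; §4 pp. 48–49] [cite: LangeBirkenhake1992, Ch. 1 Prop. 1.2.1 and Ch. 2 Cor. 2.1.17] -/
theorem exists_hom_forall_map_r_eq_of_forall_mem (m : SiegelAdelicMarking J a A) (m' : SiegelAdelicMarking J' a' A')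
    (q : Matrix (Fin g ⊕ Fin g) (Fin g ⊕ Fin g) ℚ)
    (hqJ : q.map (algebraMap ℚ ℝ) * (J : Matrix (Fin g ⊕ Fin g) (Fin g ⊕ Fin g) ℝ) =
      (J' : Matrix (Fin g ⊕ Fin g) (Fin g ⊕ Fin g) ℝ) * q.map (algebraMap ℚ ℝ))
    (hq : ∀ v ∈ latticeOfGL (a : GL (Fin g ⊕ Fin g) finAdeleQ), q *ᵥ v ∈ latticeOfGL (a' : GL (Fin g ⊕ Fin g) finAdeleQ)) :
    ∃ h : A ⟶ A', ∀ v : Fin g ⊕ Fin g → ℚ, AlgPoints.map h.hom.hom.hom (m.r v) = m'.r (q *ᵥ v) := by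
  obtain ⟨N, hN⟩ := exists_int_matrix_of_forall_mem m m' q hq
  exact exists_hom_forall_map_r_eq m m' q hqJ N hN

/-! ### §4. Homomorphisms out of a marked variety are determined on `u_a(V) = A(ℂ)_tors` -/

/-- **A homomorphism out of a marked `A` is determined by its values on `u_a(V)`** (★ `hom_eq_of_forall_torsionPoints_map`,
[Milne1986AbelianVarieties] Lemma 12.6). [cite: Milne1986AbelianVarieties, §12 Lemma 12.6] [cite: MumfordAV1970, §19 Thm. 3 and Cor. 1] -/
theorem hom_eq_of_forall_map_r_eq (m : SiegelAdelicMarking J a A) {B : AbelianVariety ℂ} (f f' : A ⟶ B)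
    (h : ∀ v : Fin g ⊕ Fin g → ℚ, AlgPoints.map f.hom.hom.hom (m.r v) = AlgPoints.map f'.hom.hom.hom (m.r v)) :
    f = f' := by
  refine AbelianVariety.hom_eq_of_forall_torsionPoints_map f f' fun n hn Q hQ => ?_
  obtain ⟨v, rfl⟩ := m.exists_r_eq_of_mem_torsionPoints (Nat.pos_iff_ne_zero.1 hn) hQ
  exact h v

/-! ### §5. Isomorphisms: both `q` and `q⁻¹` lattice-compatible; two markings of one point -/

/-- **ISOMORPHISM OF THE MARKED VARIETIES.**  If `q ∈ GL_{2g}(ℚ)` is `ℂ`-linear for `(J, J′)` and both `γ′⁻¹ q γ` and `γ⁻¹ q⁻¹ γ′`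
are integral (`q·Λ_a = Λ_{a′}`), the homomorphism of §3 is an ISOMORPHISM `e : A ≅ A′` with `e(u_a v) = u_{a′}(q v)` — the
tree form of «an isomorphism from one triple `(A, s, ηK)` to a second» ([Milne2005ShimuraVarieties] p. 74, Thm. 6.11), Siegel
twin of ★ (G3) `CMTypeUniformization.exists_iso_forall_map_r_eq`. [cite: Milne2005ShimuraVarieties, §6 Thm. 6.11]
[cite: LangeBirkenhake1992, Ch. 1 Prop. 1.2.1 and Ch. 2 Cor. 2.1.17] [cite: Shimura1998, §7.4 Prop. 17 p. 54] -/
theorem exists_iso_forall_map_r_eq (m : SiegelAdelicMarking J a A) (m' : SiegelAdelicMarking J' a' A')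
    (q : GL (Fin g ⊕ Fin g) ℚ)
    (hqJ : ((q : GL (Fin g ⊕ Fin g) ℚ) : Matrix (Fin g ⊕ Fin g) (Fin g ⊕ Fin g) ℚ).map (algebraMap ℚ ℝ) *
        (J : Matrix (Fin g ⊕ Fin g) (Fin g ⊕ Fin g) ℝ) =
      (J' : Matrix (Fin g ⊕ Fin g) (Fin g ⊕ Fin g) ℝ) *
        ((q : GL (Fin g ⊕ Fin g) ℚ) : Matrix (Fin g ⊕ Fin g) (Fin g ⊕ Fin g) ℚ).map (algebraMap ℚ ℝ))
    (N N' : Matrix (Fin g ⊕ Fin g) (Fin g ⊕ Fin g) ℤ)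
    (hN : N.map (Int.cast : ℤ → ℚ) =
      ((m'.γ⁻¹ : GL (Fin g ⊕ Fin g) ℚ) : Matrix (Fin g ⊕ Fin g) (Fin g ⊕ Fin g) ℚ) * (q : Matrix (Fin g ⊕ Fin g) (Fin g ⊕ Fin g) ℚ) *
        ((m.γ : GL (Fin g ⊕ Fin g) ℚ) : Matrix (Fin g ⊕ Fin g) (Fin g ⊕ Fin g) ℚ))
    (hN' : N'.map (Int.cast : ℤ → ℚ) =
      ((m.γ⁻¹ : GL (Fin g ⊕ Fin g) ℚ) : Matrix (Fin g ⊕ Fin g) (Fin g ⊕ Fin g) ℚ) *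
        ((q⁻¹ : GL (Fin g ⊕ Fin g) ℚ) : Matrix (Fin g ⊕ Fin g) (Fin g ⊕ Fin g) ℚ) *
          ((m'.γ : GL (Fin g ⊕ Fin g) ℚ) : Matrix (Fin g ⊕ Fin g) (Fin g ⊕ Fin g) ℚ)) :
    ∃ e : A ≅ A', ∀ v : Fin g ⊕ Fin g → ℚ,
      AlgPoints.map e.hom.hom.hom.hom (m.r v) = m'.r ((q : Matrix (Fin g ⊕ Fin g) (Fin g ⊕ Fin g) ℚ) *ᵥ v) := by
  -- `q⁻¹` is `ℂ`-linear for `(J′, J)`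
  have hqJ' : ((q⁻¹ : GL (Fin g ⊕ Fin g) ℚ) : Matrix (Fin g ⊕ Fin g) (Fin g ⊕ Fin g) ℚ).map (algebraMap ℚ ℝ) *
        (J' : Matrix (Fin g ⊕ Fin g) (Fin g ⊕ Fin g) ℝ) =
      (J : Matrix (Fin g ⊕ Fin g) (Fin g ⊕ Fin g) ℝ) *
        ((q⁻¹ : GL (Fin g ⊕ Fin g) ℚ) : Matrix (Fin g ⊕ Fin g) (Fin g ⊕ Fin g) ℚ).map (algebraMap ℚ ℝ) := by
    have h1 := congr_arg (fun X => ((q⁻¹ : GL (Fin g ⊕ Fin g) ℚ) : Matrix _ _ ℚ).map (algebraMap ℚ ℝ) * X *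
      ((q⁻¹ : GL (Fin g ⊕ Fin g) ℚ) : Matrix _ _ ℚ).map (algebraMap ℚ ℝ)) hqJ
    rw [← Matrix.mul_assoc, ← Matrix.mul_assoc, map_inv_mul_map, Matrix.one_mul, Matrix.mul_assoc, Matrix.mul_assoc,
      map_mul_map_inv, Matrix.mul_one] at h1
    exact h1.symm
  obtain ⟨h, hh⟩ := exists_hom_forall_map_r_eq m m' (q : Matrix _ _ ℚ) hqJ N hN
  obtain ⟨h', hh'⟩ := exists_hom_forall_map_r_eq m' m ((q⁻¹ : GL (Fin g ⊕ Fin g) ℚ) : Matrix _ _ ℚ) hqJ' N' hN'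
  have hhh' : h ≫ h' = 𝟙 A := by
    refine m.hom_eq_of_forall_map_r_eq _ _ fun v => ?_
    rw [AbelianVariety.map_hom_comp, hh, hh', Matrix.mulVec_mulVec, ← Units.val_mul, inv_mul_cancel, Units.val_one,
      Matrix.one_mulVec, AbelianVariety.map_hom_id]
  have hh'h : h' ≫ h = 𝟙 A' := by
    refine m'.hom_eq_of_forall_map_r_eq _ _ fun v => ?_
    rw [AbelianVariety.map_hom_comp, hh', hh, Matrix.mulVec_mulVec, ← Units.val_mul, mul_inv_cancel, Units.val_one,
      Matrix.one_mulVec, AbelianVariety.map_hom_id]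
  exact ⟨⟨h, h', hhh', hh'h⟩, hh⟩

/-- **TWO MARKINGS OF THE SAME POINT `[J, a]` DIFFER BY AN ISOMORPHISM OF ABELIAN VARIETIES MATCHING THE TORSION PARAMETRISATIONS**:
for `m : SiegelAdelicMarking J a A` and `m′ : SiegelAdelicMarking J a A′` there is `e : A ≅ A′` with `e(u(v)) = u′(v)` for all `v ∈ V`
(`q = 1`: `γ′⁻¹ γ` and `γ⁻¹ γ′` are integral because both are bases of `Λ_a`).  So the moduli reading's quantification over ALL markings
of a point costs nothing: any two give isomorphic marked triples ([Milne2005ShimuraVarieties] Thm. 6.11, well-definedness of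
`(A, s, ηK) ↦ [x, a]`). [cite: Milne2005ShimuraVarieties, §6 Thm. 6.11] [cite: LangeBirkenhake1992, Ch. 1 Prop. 1.2.1 and Ch. 2 Cor. 2.1.17] -/
theorem exists_iso_forall_map_r_eq_self (m : SiegelAdelicMarking J a A) (m' : SiegelAdelicMarking J a A') :
    ∃ e : A ≅ A', ∀ v : Fin g ⊕ Fin g → ℚ, AlgPoints.map e.hom.hom.hom.hom (m.r v) = m'.r v := by
  have hq1 : ∀ v ∈ latticeOfGL (a : GL (Fin g ⊕ Fin g) finAdeleQ),
      (1 : Matrix (Fin g ⊕ Fin g) (Fin g ⊕ Fin g) ℚ) *ᵥ v ∈ latticeOfGL (a : GL (Fin g ⊕ Fin g) finAdeleQ) :=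
    fun v hv => by rwa [Matrix.one_mulVec]
  obtain ⟨N, hN⟩ := exists_int_matrix_of_forall_mem m m' 1 hq1
  obtain ⟨N', hN'⟩ := exists_int_matrix_of_forall_mem m' m 1 hq1
  have hJ : ((1 : GL (Fin g ⊕ Fin g) ℚ) : Matrix (Fin g ⊕ Fin g) (Fin g ⊕ Fin g) ℚ).map (algebraMap ℚ ℝ) *
        (J : Matrix (Fin g ⊕ Fin g) (Fin g ⊕ Fin g) ℝ) =
      (J : Matrix (Fin g ⊕ Fin g) (Fin g ⊕ Fin g) ℝ) *
        ((1 : GL (Fin g ⊕ Fin g) ℚ) : Matrix (Fin g ⊕ Fin g) (Fin g ⊕ Fin g) ℚ).map (algebraMap ℚ ℝ) := by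
    rw [Units.val_one, Matrix.map_one _ (map_zero _) (map_one _), Matrix.one_mul, Matrix.mul_one]
  obtain ⟨e, he⟩ := exists_iso_forall_map_r_eq m m' 1 hJ N N' (by rw [hN, Units.val_one, Matrix.mul_one])
    (by rw [hN', inv_one, Units.val_one, Matrix.mul_one])
  exact ⟨e, fun v => by rw [he, Units.val_one, Matrix.one_mulVec]⟩

/-! ### §6. T1′-typed corollaries of the M3a-α hetero junction (★-to-be `SiegelCMTorusMapsOfChart`, A-p06, chart currency) -/

section CMJunction

open Literature.NumberTheory.ComplexMultiplication (CMTypeUniformization)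
open Literature.NumberTheory.ComplexMultiplication.CMTypeLattice (cmEmbedding)

variable {ι : Type} [Fintype ι] [DecidableEq ι] {K : ι → Type} [∀ i, Field (K i)] [∀ i, NumberField (K i)]
  [∀ i, IsCMField (K i)] {c : CMStructure g δ ι K} {Φ : ∀ i, CMType (K i)}

omit [DecidableEq ι] in
/-- **STEP χ (down) FOR A MARKING**: at a special pair with `J`-linear chart `e` normalised at the cyclic vector `v₀` (★ R60-33), a marking `m`
of `A` by `[J, a]` and a structure `(B, ιB, ξ)` of type `(Kᵢ, Φᵢ, 𝔟)`: if the lattice `Λ_a` read in `F` has `i`-th components in `𝔟`, there is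
`χ : A ⟶ B` with `χ(m.r (act(x)·v₀)) = ξ.r (x i)` — A-p06's chart-currency `CMStructure.exists_hom_map_chart_eq_r` at the marking's own chart
`(γ, Ψ, toFun)`. [cite: Shimura1998, §7.4 Prop. 15 p. 53] [cite: Deligne1971TravauxShimura, 4.19 p. 151] [cite: Milne2005ShimuraVarieties, §6 Thm. 6.11] -/
theorem exists_hom_map_r_act_eq_r (m : SiegelAdelicMarking J a A)
    (e : (Fin g ⊕ Fin g → ℝ) ≃ₗ[ℝ] (Π i, ((Φ i).1 → ℂ)))
    (heJ : ∀ v, e ((J : Matrix (Fin g ⊕ Fin g) (Fin g ⊕ Fin g) ℝ) *ᵥ v) = Complex.I • e v)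
    {v₀ : Fin g ⊕ Fin g → ℚ} (hv₀ : Function.Bijective fun x : Π i, K i => c.act x v₀)
    (he : ∀ x : Π i, K i, e ((algebraMap ℚ ℝ) ∘ (c.act x v₀)) = fun i => cmEmbedding (Φ i) (x i))
    (i : ι) {𝔟 : (FractionalIdeal (𝓞 (K i))⁰ (K i))ˣ} {B : AbelianVariety ℂ} {ιB : 𝓞 (K i) →+* End B}
    (ξ : CMTypeUniformization (Φ i) 𝔟 B ιB)
    (h𝔟 : ∀ x : Π i, K i, c.act x v₀ ∈ latticeOfGL (a : GL (Fin g ⊕ Fin g) finAdeleQ) →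
      x i ∈ ((𝔟 : FractionalIdeal (𝓞 (K i))⁰ (K i)) : Set (K i))) :
    ∃ χ : A ⟶ B, ∀ x : Π i, K i, AlgPoints.map χ.hom.hom.hom (m.r (c.act x v₀)) = ξ.r (x i) := by
  have hΛ := (isLatticeBasis_iff_latticeOfGL_eq a m.γ).1 m.γ_isLatticeBasis
  have hdown : ∀ k : Fin g ⊕ Fin g, ∃ x : Π i, K i,
      c.act x v₀ = (fun j => ((m.γ : GL (Fin g ⊕ Fin g) ℚ) : Matrix (Fin g ⊕ Fin g) (Fin g ⊕ Fin g) ℚ) j k) ∧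
        x i ∈ ((𝔟 : FractionalIdeal (𝓞 (K i))⁰ (K i)) : Set (K i)) := by
    intro k
    obtain ⟨x, hx⟩ := hv₀.2 fun j => ((m.γ : GL (Fin g ⊕ Fin g) ℚ) : Matrix (Fin g ⊕ Fin g) (Fin g ⊕ Fin g) ℚ) j k
    refine ⟨x, hx, h𝔟 x ?_⟩
    rw [show c.act x v₀ = _ from hx, hΛ, mem_latticeOfGL_map_iff_exists]
    exact ⟨Pi.single k 1, by funext j; simp [Matrix.mulVec, dotProduct, Pi.single_apply]⟩
  obtain ⟨χ, hχ⟩ := c.exists_hom_map_chart_eq_r Φ he heJ m.Ψ_J m.isAnalytification m.toFun_zero i ξ hdown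
  exact ⟨χ, fun x => by rw [m.r_def]; exact hχ x⟩

/-- **STEP θ (up) FOR A MARKING**: same data, `(B, ιB, ξ)` ANY structure of type `(Kᵢ, Φᵢ, 𝔟)` (e.g. the `ξ′` of Thm. 18.6 (2) on `Bᵢ^σ`), `M ∈ ℕ`:
if `act(ιᵢ(M·y))·v₀ ∈ Λ_a` for all `y ∈ 𝔟`, there is `θ : B ⟶ A` with `θ(ξ.r y) = m.r (act(ιᵢ(M·y))·v₀)` — A-p06's
`CMStructure.exists_hom_map_r_eq_chart` at the marking's chart. [cite: Shimura1998, §7.4 Prop. 15 p. 53; §18.6 Thm. 18.6 (2) pp. 124–125]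
[cite: Deligne1971TravauxShimura, 4.19 p. 151] [cite: Milne2005ShimuraVarieties, §6 Thm. 6.11] -/
theorem exists_hom_map_r_eq_r_act_single (m : SiegelAdelicMarking J a A)
    (e : (Fin g ⊕ Fin g → ℝ) ≃ₗ[ℝ] (Π i, ((Φ i).1 → ℂ)))
    (heJ : ∀ v, e ((J : Matrix (Fin g ⊕ Fin g) (Fin g ⊕ Fin g) ℝ) *ᵥ v) = Complex.I • e v)
    {v₀ : Fin g ⊕ Fin g → ℚ}
    (he : ∀ x : Π i, K i, e ((algebraMap ℚ ℝ) ∘ (c.act x v₀)) = fun i => cmEmbedding (Φ i) (x i))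
    (i : ι) {𝔟 : (FractionalIdeal (𝓞 (K i))⁰ (K i))ˣ} {B : AbelianVariety ℂ} {ιB : 𝓞 (K i) →+* End B}
    (ξ : CMTypeUniformization (Φ i) 𝔟 B ιB) (M : ℕ)
    (h𝔟 : ∀ y : K i, y ∈ ((𝔟 : FractionalIdeal (𝓞 (K i))⁰ (K i)) : Set (K i)) →
      c.act (Pi.single i ((M : K i) * y)) v₀ ∈ latticeOfGL (a : GL (Fin g ⊕ Fin g) finAdeleQ)) :
    ∃ θ : B ⟶ A, ∀ y : K i, AlgPoints.map θ.hom.hom.hom (ξ.r y) = m.r (c.act (Pi.single i ((M : K i) * y)) v₀) := by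
  have hΛ := (isLatticeBasis_iff_latticeOfGL_eq a m.γ).1 m.γ_isLatticeBasis
  have hup : ∀ y : K i, y ∈ ((𝔟 : FractionalIdeal (𝓞 (K i))⁰ (K i)) : Set (K i)) → ∃ z : Fin g ⊕ Fin g → ℤ,
      (((m.γ⁻¹ : GL (Fin g ⊕ Fin g) ℚ) : Matrix (Fin g ⊕ Fin g) (Fin g ⊕ Fin g) ℚ) *ᵥ
        c.act (Pi.single i ((M : K i) * y)) v₀) = fun j => (z j : ℚ) := by
    intro y hy
    have hw := h𝔟 y hy
    rw [hΛ, mem_latticeOfGL_map_iff] at hw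
    choose z hz using hw
    exact ⟨z, funext fun j => (hz j).symm⟩
  obtain ⟨θ, hθ⟩ := c.exists_hom_map_r_eq_chart Φ he heJ m.Ψ_J m.isAnalytification m.toFun_zero i ξ M hup
  exact ⟨θ, fun y => by rw [m.r_def]; exact hθ y⟩

end CMJunction

end SiegelAdelicMarking

end Literature.AlgebraicGeometry.ModuliOfAbelianVarieties

end
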